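/-
Copyright (c) 2026 the pub-hodgecm-mathlib formalisation cell (harness21).  Prover seat hodgecm-mathlib-K2E3-p25 (g4), Track B «K2-LIT»,
#184♮ = hLiu418 = `stmt-HodgeConjecture-24832`; F4 (G-gen) road (E), brick (E-d-P-fin)′ = ★ p863344 `K2LiuArchSWPivotOfRecord` WITH ITS SIX RIGHT-LEG LETTERS DISCHARGED
BY NAME at the junction frames of record (F4 desk K2Liu-p27 (g3) WORD #1 (c) 2026-09-05T00:36:27Z «(A) GO exactly as offered»; FRAMES OF RECORD 00:19:48Z).
THEOREMS ONLY (no `def`, no `instance`, no notation, no named-fact hypothesis, no `sorry`); lane `--supports stmt-HodgeConjecture-24832 --as helper`.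
-/
import Summits.HodgeConjecture.HodgeConjecture.Theorems.K2LiuArchSWPivotOfRecord          -- ★ p863344 (K2Liu-p27): the pivot modulo `kk hkk xx hdet hxσ hx`
import Summits.HodgeConjecture.HodgeConjecture.Theorems.K2LiuArchPlaceSecJPartnerEmb      -- ★ p863593 (R-grp) (iii): `formCongr_yFrame`, `partnerEmb_kHat_eq_archEmb_placeSecJ_κ`
import Summits.HodgeConjecture.HodgeConjecture.Theorems.K2LiuArchPlaceSecDet              -- ★ p863469 (R-det) (K2Liu-p26): `exists_det_letters_adelicSingle_kV`
import HarnessLib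

/-!
# Crux `HLiu418`, organ F4 (G-gen), road (E): THE SEE-SAW PIVOT AT THE BIG CM DATUM, right-leg letters discharged at the junction frames of record

Cell `hodgecm-mathlib`, crux item hLiu418 = `stmt-HodgeConjecture-24832` (helper lane `--supports`, count-neutral; closes no socket).

★ p863344 `K2LiuArchSWPivotOfRecord.swSection_junctionSlot_κOp_eq_vacScalar_mul` proves the (E-d) pivot `f_{E(a′ ⊗ f)}(h ⊗ 1) = vacScalar (1,k) · f_{E(a ⊗ f)}(h ⊗ 1)`
modulo six by-value letters about ONE partner datum `kk k ∈ U(V′)(𝔸)`: `hkk` (the right-leg group identity (R-grp)) and `xx, hdet, hxσ, hx` (its determinant as the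
`w(σ)`-single infinite idele of `det c · det d`).  Both are ★ now for the datum of the RAW `y`-frame of `V′_σ`,
`k̂ σ u := adelicSingle_{V′} (cmPlaceOver L σ) ((toUFormEquiv (signSplit y) _ one_ne_zero (formCongr_yFrame …)).symm u)`:
(R-grp) = ★ p863593 `K2LiuArchPlaceSecJPartnerEmb.partnerEmb_kHat_eq_archEmb_placeSecJ_κ` (K2E3-p25 ∕ K2E3-p31), (R-det) = ★ p863469
`K2LiuArchPlaceSecDet.exists_det_letters_adelicSingle_kV` (K2Liu-p26).  This file substitutes them:
* §0 **`embedding_dV'_ne_zero`**, **`exists_junctionFrameData_embedding`** — ★ `K2LiuArchJunctionFrameData.exists_junctionFrameData` with the real vector EXPOSED,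
  `y₀ σ k := embedding_of_isReal σ.2 ⟨dV′ k, _⟩` (not `∃`-bound): `∃ (eP₀ eQ₀ : ∀ σ, …), ∀ σ i, hE` at `y₀` (★ FILE 2a `sumCongr_tensorEquiv_compatible` keyed on ★ `signVec_tensor`);
  with `hy := embedding_dV'_ne_zero`, `hz := ★ signVec_tensor`, `hyσ := fun _ => rfl` this is the frame tuple every right-leg letter below (and ★ p863593, ★ p863578) consumes.
* **`swSection_junctionSlot_κOp_eq_vacScalar_mul_at_junctionFrames`** — ★ p863344's statement with `kk := fun k => k̂ σ (kV k)` and the six letters GONE, at the FRAMES OF RECORD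
  (F4 desk 00:19:48Z): small blocks `P, Q` abstract (`|P| = |Q| = n`) placed in the sign blocks of `𝔻_σ` by `eSp : P ≃ 𝔻⁺_σ`, `eSq : Q ≃ 𝔻⁻_σ`; partner blocks
  `R, S := PosIdx y, NegIdx y` (`y = σ ∘ dV′`, letter `hyσ`); junction frame `eP := eP₀⁻¹ ≫ (eSp⁻¹ × 1 ⊕ eSq⁻¹ × 1)`, `eQ := eQ₀⁻¹ ≫ (eSp⁻¹ × 1 ⊕ eSq⁻¹ × 1)` for a tensor-sorted
  frame `(eP₀, eQ₀, hE)` of `𝕎_σ`.  NB ★ `K2LiuArchJunctionFrameData.exists_junctionFrameData` hides `y` behind `∃`, so after its `obtain` the letter `hyσ` is NOT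
  provable; use §0 **`exists_junctionFrameData_embedding`** instead (the same frame package with `y` EXPOSED as the term `fun σ k => embedding_of_isReal σ.2 ⟨dV′ k, _⟩`;
  then `hyσ := fun _ => rfl`, `hy := embedding_dV'_ne_zero …`, `hz := ★ K2LiuArchTensorPlaceSec.signVec_tensor …` — F4 desk amendment (2) 00:37:57Z).  The analytic
  binders `(f h k Φ₁ Φ₂ a a′ ha ha′)` and the conclusion are ★ p863344's BYTES under this substitution — so LH7-p07's `…Final`∕`…AtFrames` last edition binds (piv) with
  ONE name.  Proof: `obtain ⟨xx, hdet, hxσ, hx⟩ := exists_det_letters_adelicSingle_kV …` and `exact` ★ p863344 at `kk`, `hkk := partnerEmb_kHat_eq_archEmb_placeSecJ_κ …`.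
References: [KudlaRallis1994, §1]; [HarrisKudlaSweet1996, §1 (1.15)–(1.17)]; [KonnoKonno2007, §3.1 (3.1), Lemma 5.2]; [Folland1989, Prop. (4.39)]; [BorelJacquet1979, §4.1].
HONEST LABEL: HC_CM is proved only modulo the 7 printed citations (2 remaining named inputs: hLiu418 = stmt-HodgeConjecture-24832,
h413 = stmt-HodgeConjecture-24833) until rung 0 closes; count-neutral helper, closes no socket.
-/

set_option autoImplicit false
set_option linter.dupNamespace false -- the mandated namespace repeats `HodgeConjecture.HodgeConjecture`
set_option synthInstance.maxSize 512 -- `DecidableEq` of the nested block index `DPIdx ((P×R)⊕(Q×S)) ((P×S)⊕(Q×R)) Unit Empty` (structural; as ★ p863344 ∕ ★ (P-arch))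

noncomputable section

open scoped Classical Matrix TensorProduct Kronecker SchwartzMap
open NumberField NumberField.InfinitePlace NumberField.mixedEmbedding IsDedekindDomain
open Literature.Analysis.SegalBargmann Literature.RepresentationTheory.HeisenbergGroup
open Literature.NumberTheory.Automorphic Literature.NumberTheory.Automorphic.UnitaryGroup Literature.NumberTheory.GaloisRepresentations
open Literature.NumberTheory.Weil1964 Literature.NumberTheory.Weil1964.MpS Literature.NumberTheory.Weil1964.UnitaryWeil
open Literature.RepresentationTheory.HarrisKudlaSweet1996
open Literature.RepresentationTheory.KonnoKonno2007 Literature.RepresentationTheory.KonnoKonno2007.RealDualPair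
open Literature.NumberTheory.GelbartRogawski1991 Literature.NumberTheory.GelbartRogawski1991.GRConstruction
open Literature.NumberTheory.GelbartRogawski1991.UnitaryDualPair
open Literature.NumberTheory.GelbartRogawski1991.UnitaryDualPair.LocalSplitting
open Literature.NumberTheory.K2Lit.SiegelDoubled
open Summit.HodgeConjecture.HodgeConjecture.Cruxes.HLiu418.K2LiuArchSectionPlaceBlock
open Summit.HodgeConjecture.HodgeConjecture.Cruxes.HLiu418 (K2LiuArchOneParameterOrbitDefs.archEmb)
open Summit.HodgeConjecture.HodgeConjecture.Cruxes.HLiu418.K2LiuSwSectionArchOrbit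
open Summit.HodgeConjecture.HodgeConjecture.Cruxes.HLiu418.K2LiuWeilSeesawRelabel
open Summit.HodgeConjecture.HodgeConjecture.Cruxes.HLiu418.K2LiuArchWeilJunctionTransport
open Summit.HodgeConjecture.HodgeConjecture.Cruxes.HLiu418.K2LiuArchRightLegPlacePin
open Summit.HodgeConjecture.HodgeConjecture.Cruxes.HLiu418.K2LiuPartnerEmbedding
open Summit.HodgeConjecture.HodgeConjecture.Cruxes.HLiu418.K2LiuSiegelWeilSectionKFinite
open Summit.HodgeConjecture.HodgeConjecture.Cruxes.HLiu418.K2LiuArchSWPivotOfRecord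
open Summit.HodgeConjecture.HodgeConjecture.Cruxes.HLiu418.K2LiuArchPlaceSecJPartnerEmb
open Summit.HodgeConjecture.HodgeConjecture.Cruxes.HLiu418.K2LiuArchPlaceSecDet

namespace Summit.HodgeConjecture.HodgeConjecture.Cruxes.HLiu418.K2LiuArchSWPivotDischarge

variable (L : Type) [Field L] [NumberField L] [IsCMField L]
variable {N M n : ℕ} (e : Fin N × Fin M ≃ Fin n)
  (dV : Fin N → L) (hdV : ∀ i, IsCMField.complexConj L (dV i) = dV i) (hdV0 : ∀ i, dV i ≠ 0)
  (dW : Fin M → L) (hdW : ∀ i, IsCMField.complexConj L (dW i) = dW i) (hdW0 : ∀ i, dW i ≠ 0)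
variable {M₂ M' n' : ℕ} (eW : Fin M × Fin M₂ ≃ Fin M') (e' : Fin N × Fin M' ≃ Fin n')
  (dV' : Fin M₂ → L) (hdV' : ∀ k, IsCMField.complexConj L (dV' k) = dV' k) (hdV'0 : ∀ k, dV' k ≠ 0)
variable (σ : {v : InfinitePlace (Fp L) // v.IsReal})
  {P Q : Type} [Fintype P] [DecidableEq P] [Fintype Q] [DecidableEq Q]

/-! ## §0 The junction frame data with the real vector `y₀ = σ ∘ dV′` EXPOSED -/

include hdV'0 in
/-- `σ(dV′ k) ≠ 0` — the letter `hy` at the exposed real vector `y₀ σ k := embedding_of_isReal σ.2 ⟨dV′ k, _⟩` (`dV′ k ≠ 0`, `σ` injective). [cite: KonnoKonno2007, §3.1 (3.1)] -/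
theorem embedding_dV'_ne_zero (σ : {v : InfinitePlace (Fp L) // v.IsReal}) (k : Fin M₂) :
    embedding_of_isReal σ.2 (⟨dV' k, (IsCMField.complexConj_eq_self_iff (K := L) (dV' k)).1 (hdV' _)⟩ : Fp L) ≠ 0 := by
  intro h0
  have h1 : (⟨dV' k, (IsCMField.complexConj_eq_self_iff (K := L) (dV' k)).1 (hdV' _)⟩ : Fp L) = 0 :=
    (map_eq_zero_iff _ (embedding_of_isReal σ.2).injective).1 h0
  exact hdV'0 k (congrArg Subtype.val h1)

-- the CM sign frames of the big datum elaborate slowly (as ★ `K2LiuArchJunctionFrameData`: 4 000 000 heartbeats)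
set_option maxHeartbeats 4000000 in
include hdV0 hdW0 hdV'0 in
/-- **THE JUNCTION FRAME DATA WITH `y` EXPOSED** (★ `K2LiuArchJunctionFrameData.exists_junctionFrameData` minus the `∃ y`: F4 desk amendment (2) 2026-09-05T00:37:57Z): at the real vector
`y₀ σ k := σ(dV′ k)` there are, for every real place `σ`, tensor-sorted identifications `eP₀ σ : (𝔻⁺_σ × V′⁺_σ) ⊕ (𝔻⁻_σ × V′⁻_σ) ≃ 𝕎⁺_σ`, `eQ₀ σ : (𝔻⁺_σ × V′⁻_σ) ⊕ (𝔻⁻_σ × V′⁺_σ) ≃ 𝕎⁻_σ`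
compatible with the sign splittings through `dpEquiv` (`hE`, ★ FILE 2a `sumCongr_tensorEquiv_compatible` keyed on ★ `signVec_tensor`) — so the instantiator writes
`obtain ⟨eP₀, eQ₀, hE⟩ := exists_junctionFrameData_embedding …` and has `hyσ := fun _ => rfl`, `hy := embedding_dV'_ne_zero …`, `hz := signVec_tensor …` at the SAME `y₀`.
[cite: KonnoKonno2007, §3.1 (3.1)] [cite: Kudla1994, §2 (doubled space, Siegel parabolic)] -/
theorem exists_junctionFrameData_embedding :
    ∃ (eP₀ : ∀ σ : {v : InfinitePlace (Fp L) // v.IsReal}, (PosIdx (signVec (cmPlaceOver L)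
          (fun k => Sum.elim (cmGramEntry L e dV hdV dW hdW) (-cmGramEntry L e dV hdV dW hdW) ((LocalSplitting.e₂ n).symm k)) (imagUnit L) σ) × PosIdx (fun k : Fin M₂ => embedding_of_isReal σ.2 (⟨dV' k, (IsCMField.complexConj_eq_self_iff (K := L) (dV' k)).1 (hdV' _)⟩ : Fp L))) ⊕
        (NegIdx (signVec (cmPlaceOver L)
          (fun k => Sum.elim (cmGramEntry L e dV hdV dW hdW) (-cmGramEntry L e dV hdV dW hdW) ((LocalSplitting.e₂ n).symm k)) (imagUnit L) σ) × NegIdx (fun k : Fin M₂ => embedding_of_isReal σ.2 (⟨dV' k, (IsCMField.complexConj_eq_self_iff (K := L) (dV' k)).1 (hdV' _)⟩ : Fp L))) ≃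
      PosIdx (signVec (cmPlaceOver L)
        (fun k => Sum.elim (cmGramEntry L e' dV hdV (tensorFrame L dW eW dV') (tensorFrame_real L dW hdW eW dV' hdV'))
          (-cmGramEntry L e' dV hdV (tensorFrame L dW eW dV') (tensorFrame_real L dW hdW eW dV' hdV')) ((LocalSplitting.e₂ n').symm k))
        (imagUnit L) σ)) (eQ₀ : ∀ σ : {v : InfinitePlace (Fp L) // v.IsReal}, (PosIdx (signVec (cmPlaceOver L)
          (fun k => Sum.elim (cmGramEntry L e dV hdV dW hdW) (-cmGramEntry L e dV hdV dW hdW) ((LocalSplitting.e₂ n).symm k)) (imagUnit L) σ) × NegIdx (fun k : Fin M₂ => embedding_of_isReal σ.2 (⟨dV' k, (IsCMField.complexConj_eq_self_iff (K := L) (dV' k)).1 (hdV' _)⟩ : Fp L))) ⊕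
        (NegIdx (signVec (cmPlaceOver L)
          (fun k => Sum.elim (cmGramEntry L e dV hdV dW hdW) (-cmGramEntry L e dV hdV dW hdW) ((LocalSplitting.e₂ n).symm k)) (imagUnit L) σ) × PosIdx (fun k : Fin M₂ => embedding_of_isReal σ.2 (⟨dV' k, (IsCMField.complexConj_eq_self_iff (K := L) (dV' k)).1 (hdV' _)⟩ : Fp L))) ≃
      NegIdx (signVec (cmPlaceOver L)
        (fun k => Sum.elim (cmGramEntry L e' dV hdV (tensorFrame L dW eW dV') (tensorFrame_real L dW hdW eW dV' hdV'))
          (-cmGramEntry L e' dV hdV (tensorFrame L dW eW dV') (tensorFrame_real L dW hdW eW dV' hdV')) ((LocalSplitting.e₂ n').symm k))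
        (imagUnit L) σ)), ∀ (σ : {v : InfinitePlace (Fp L) // v.IsReal}) i, (dpEquiv _ _ _ _).symm (((eP₀ σ).sumCongr (eQ₀ σ)).symm i) =
      (signSplit (signVec (cmPlaceOver L)
          (fun k => Sum.elim (cmGramEntry L e dV hdV dW hdW) (-cmGramEntry L e dV hdV dW hdW) ((LocalSplitting.e₂ n).symm k)) (imagUnit L) σ)
        ((epsD e eW e').symm ((signSplit (signVec (cmPlaceOver L)
          (fun k => Sum.elim (cmGramEntry L e' dV hdV (tensorFrame L dW eW dV') (tensorFrame_real L dW hdW eW dV' hdV'))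
            (-cmGramEntry L e' dV hdV (tensorFrame L dW eW dV') (tensorFrame_real L dW hdW eW dV' hdV')) ((LocalSplitting.e₂ n').symm k))
          (imagUnit L) σ)).symm i)).1,
       signSplit (fun k : Fin M₂ => embedding_of_isReal σ.2 (⟨dV' k, (IsCMField.complexConj_eq_self_iff (K := L) (dV' k)).1 (hdV' _)⟩ : Fp L)) ((epsD e eW e').symm ((signSplit (signVec (cmPlaceOver L)
          (fun k => Sum.elim (cmGramEntry L e' dV hdV (tensorFrame L dW eW dV') (tensorFrame_real L dW hdW eW dV' hdV'))
            (-cmGramEntry L e' dV hdV (tensorFrame L dW eW dV') (tensorFrame_real L dW hdW eW dV' hdV')) ((LocalSplitting.e₂ n').symm k))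
          (imagUnit L) σ)).symm i)).2) := by
  -- the sign vectors of `𝔻` do not vanish
  have hx : ∀ (σ : {v : InfinitePlace (Fp L) // v.IsReal}) i, signVec (cmPlaceOver L)
      (fun k => Sum.elim (cmGramEntry L e dV hdV dW hdW) (-cmGramEntry L e dV hdV dW hdW) ((LocalSplitting.e₂ n).symm k)) (imagUnit L) σ i ≠ 0 :=
    fun σ => signVec_ne_zero (IsCMField.complexConj_ne_one L) (cmPlaceOver_smul L) (complexConj_imagUnit L) (imagUnit_ne_zero L)
      (gramD_gram_realDiagonal_entry_ne_zero L e dV hdV dW hdW hdV0 hdW0) σ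
  have hEx := fun σ : {v : InfinitePlace (Fp L) // v.IsReal} =>
    (⟨_, _, K2LiuArchTensorFrameChase.sumCongr_tensorEquiv_compatible _ _ (epsD e eW e') (hx σ) (embedding_dV'_ne_zero L dV' hdV' hdV'0 σ) _
        (K2LiuArchTensorPlaceSec.signVec_tensor L e dV hdV dW hdW eW e' dV' hdV' σ)⟩ :
      ∃ (eP :(PosIdx (signVec (cmPlaceOver L)
          (fun k => Sum.elim (cmGramEntry L e dV hdV dW hdW) (-cmGramEntry L e dV hdV dW hdW) ((LocalSplitting.e₂ n).symm k)) (imagUnit L) σ) × PosIdx (fun k : Fin M₂ => embedding_of_isReal σ.2 (⟨dV' k, (IsCMField.complexConj_eq_self_iff (K := L) (dV' k)).1 (hdV' _)⟩ : Fp L))) ⊕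
        (NegIdx (signVec (cmPlaceOver L)
          (fun k => Sum.elim (cmGramEntry L e dV hdV dW hdW) (-cmGramEntry L e dV hdV dW hdW) ((LocalSplitting.e₂ n).symm k)) (imagUnit L) σ) × NegIdx (fun k : Fin M₂ => embedding_of_isReal σ.2 (⟨dV' k, (IsCMField.complexConj_eq_self_iff (K := L) (dV' k)).1 (hdV' _)⟩ : Fp L))) ≃
      PosIdx (signVec (cmPlaceOver L)
        (fun k => Sum.elim (cmGramEntry L e' dV hdV (tensorFrame L dW eW dV') (tensorFrame_real L dW hdW eW dV' hdV'))
          (-cmGramEntry L e' dV hdV (tensorFrame L dW eW dV') (tensorFrame_real L dW hdW eW dV' hdV')) ((LocalSplitting.e₂ n').symm k))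
        (imagUnit L) σ)) (eQ :(PosIdx (signVec (cmPlaceOver L)
          (fun k => Sum.elim (cmGramEntry L e dV hdV dW hdW) (-cmGramEntry L e dV hdV dW hdW) ((LocalSplitting.e₂ n).symm k)) (imagUnit L) σ) × NegIdx (fun k : Fin M₂ => embedding_of_isReal σ.2 (⟨dV' k, (IsCMField.complexConj_eq_self_iff (K := L) (dV' k)).1 (hdV' _)⟩ : Fp L))) ⊕
        (NegIdx (signVec (cmPlaceOver L)
          (fun k => Sum.elim (cmGramEntry L e dV hdV dW hdW) (-cmGramEntry L e dV hdV dW hdW) ((LocalSplitting.e₂ n).symm k)) (imagUnit L) σ) × PosIdx (fun k : Fin M₂ => embedding_of_isReal σ.2 (⟨dV' k, (IsCMField.complexConj_eq_self_iff (K := L) (dV' k)).1 (hdV' _)⟩ : Fp L))) ≃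
      NegIdx (signVec (cmPlaceOver L)
        (fun k => Sum.elim (cmGramEntry L e' dV hdV (tensorFrame L dW eW dV') (tensorFrame_real L dW hdW eW dV' hdV'))
          (-cmGramEntry L e' dV hdV (tensorFrame L dW eW dV') (tensorFrame_real L dW hdW eW dV' hdV')) ((LocalSplitting.e₂ n').symm k))
        (imagUnit L) σ)),∀ i, (dpEquiv _ _ _ _).symm ((eP.sumCongr eQ).symm i) =
      (signSplit (signVec (cmPlaceOver L)
          (fun k => Sum.elim (cmGramEntry L e dV hdV dW hdW) (-cmGramEntry L e dV hdV dW hdW) ((LocalSplitting.e₂ n).symm k)) (imagUnit L) σ)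
        ((epsD e eW e').symm ((signSplit (signVec (cmPlaceOver L)
          (fun k => Sum.elim (cmGramEntry L e' dV hdV (tensorFrame L dW eW dV') (tensorFrame_real L dW hdW eW dV' hdV'))
            (-cmGramEntry L e' dV hdV (tensorFrame L dW eW dV') (tensorFrame_real L dW hdW eW dV' hdV')) ((LocalSplitting.e₂ n').symm k))
          (imagUnit L) σ)).symm i)).1,
       signSplit (fun k : Fin M₂ => embedding_of_isReal σ.2 (⟨dV' k, (IsCMField.complexConj_eq_self_iff (K := L) (dV' k)).1 (hdV' _)⟩ : Fp L)) ((epsD e eW e').symm ((signSplit (signVec (cmPlaceOver L)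
          (fun k => Sum.elim (cmGramEntry L e' dV hdV (tensorFrame L dW eW dV') (tensorFrame_real L dW hdW eW dV' hdV'))
            (-cmGramEntry L e' dV hdV (tensorFrame L dW eW dV') (tensorFrame_real L dW hdW eW dV' hdV')) ((LocalSplitting.e₂ n').symm k))
          (imagUnit L) σ)).symm i)).2))
  choose eP eQ hE using hEx
  exact ⟨eP, eQ, hE⟩

/-! ## §1 The pivot at the junction frames of record -/

-- the doubled metaplectic carrier of the big datum and the CM sign frames elaborate slowly (★ p863344 ∕ ★ (P-arch) ∕ ★ J2c: 4 000 000 heartbeats for the statement)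
set_option maxHeartbeats 4000000 in
/-- **(E-d-P-fin)′ THE SEE-SAW PIVOT AT THE BIG CM DATUM, RIGHT-LEG LETTERS DISCHARGED** — ★ p863344 `swSection_junctionSlot_κOp_eq_vacScalar_mul` at the partner datum
`kk k := k̂ σ (kV k) = adelicSingle_{V′} (cmPlaceOver L σ) ((toUFormEquiv (signSplit y) _ one_ne_zero (formCongr_yFrame …)).symm (kV k))` of the RAW `y`-frame, with
`hkk := ★ partnerEmb_kHat_eq_archEmb_placeSecJ_κ` ((R-grp), ★ p863593) and `⟨xx, hdet, hxσ, hx⟩ := ★ exists_det_letters_adelicSingle_kV` ((R-det), ★ p863469), at the FRAMES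
OF RECORD: `P, Q` abstract (`|P| = |Q| = n`) via `eSp : P ≃ 𝔻⁺_σ`, `eSq : Q ≃ 𝔻⁻_σ`; `R, S := PosIdx y, NegIdx y`; junction frame `eP₀⁻¹ ≫ (eSp⁻¹ × 1 ⊕ eSq⁻¹ × 1)`,
`eQ₀⁻¹ ≫ (eSp⁻¹ × 1 ⊕ eSq⁻¹ × 1)`.  For a `χ`-normalised doubled Weil representation `sB` (`χ` unitary, splitting, odd unitary archimedean type `(t,0)`), a finite vector `f`,
`h ∈ U(𝔻)(𝔸)`, `k = (c,d) ∈ U(V′⁺_σ) × U(V′⁻_σ)` and arch data `a, a′` with junction readings `𝒥 a = (e_* Φ₁) ⊠ Φ₂`, `𝒥 a′ = (e_* (κOp (1,k) Φ₁)) ⊠ Φ₂`: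
`f_{E(a′ ⊗ f)}(h ⊗ 1) = vacScalar ⟨−|S|,−|R|,−|Q|,−|P|⟩ (1,k) · f_{E(a ⊗ f)}(h ⊗ 1)`.
[cite: KudlaRallis1994, §1] [cite: HarrisKudlaSweet1996, §1 (1.15)–(1.17)] [cite: KonnoKonno2007, Lemma 5.2 p. 73] [cite: Folland1989, §4.2 Prop. (4.39)] -/
theorem swSection_junctionSlot_κOp_eq_vacScalar_mul_at_junctionFrames {χ : HeckeCharacter L} (hχu : χ.IsUnitary) (hχs : IsSplittingChar L 1 χ)
    {sB : HA L e' dV hdV (tensorFrame L dW eW dV') (tensorFrame_real L dW hdW eW dV' hdV') →*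
      MpD L e' dV hdV (tensorFrame L dW eW dV') (tensorFrame_real L dW hdW eW dV' hdV')}
    (hsB : IsDoubledWeilRep L e' dV hdV hdV0 (tensorFrame L dW eW dV') (tensorFrame_real L dW hdW eW dV' hdV')
      (tensorFrame_ne_zero L dW eW dV' hdW0 hdV'0) χ sB)
    {t : InfinitePlace L → ℤ} (ht : χ.HasUnitaryArchType t 0) (hodd : ∀ w, Odd (t w))
    (hPn : Fintype.card P = n) (hQn : Fintype.card Q = n)
    (y : Fin M₂ → ℝ) (hy : ∀ k, y k ≠ 0)
    (hyσ : ∀ k, embedding_of_isReal σ.2 (⟨dV' k, (IsCMField.complexConj_eq_self_iff (K := L) (dV' k)).1 (hdV' _)⟩ : Fp L) = y k)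
    (hz : ∀ j, signVec (cmPlaceOver L) (fun k => Sum.elim (cmGramEntry L e' dV hdV (tensorFrame L dW eW dV') (tensorFrame_real L dW hdW eW dV' hdV')) (-cmGramEntry L e' dV hdV (tensorFrame L dW eW dV') (tensorFrame_real L dW hdW eW dV' hdV')) ((LocalSplitting.e₂ n').symm k)) (imagUnit L) σ j =
      signVec (cmPlaceOver L) (fun k => Sum.elim (cmGramEntry L e dV hdV dW hdW) (-cmGramEntry L e dV hdV dW hdW) ((LocalSplitting.e₂ n).symm k)) (imagUnit L) σ ((epsD e eW e').symm j).1 * y ((epsD e eW e').symm j).2)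
    (eP₀ : (PosIdx (signVec (cmPlaceOver L) (fun k => Sum.elim (cmGramEntry L e dV hdV dW hdW) (-cmGramEntry L e dV hdV dW hdW) ((LocalSplitting.e₂ n).symm k)) (imagUnit L) σ) × PosIdx y) ⊕
        (NegIdx (signVec (cmPlaceOver L) (fun k => Sum.elim (cmGramEntry L e dV hdV dW hdW) (-cmGramEntry L e dV hdV dW hdW) ((LocalSplitting.e₂ n).symm k)) (imagUnit L) σ) × NegIdx y) ≃
      PosIdx (signVec (cmPlaceOver L) (fun k => Sum.elim (cmGramEntry L e' dV hdV (tensorFrame L dW eW dV') (tensorFrame_real L dW hdW eW dV' hdV')) (-cmGramEntry L e' dV hdV (tensorFrame L dW eW dV') (tensorFrame_real L dW hdW eW dV' hdV')) ((LocalSplitting.e₂ n').symm k)) (imagUnit L) σ))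
    (eQ₀ : (PosIdx (signVec (cmPlaceOver L) (fun k => Sum.elim (cmGramEntry L e dV hdV dW hdW) (-cmGramEntry L e dV hdV dW hdW) ((LocalSplitting.e₂ n).symm k)) (imagUnit L) σ) × NegIdx y) ⊕
        (NegIdx (signVec (cmPlaceOver L) (fun k => Sum.elim (cmGramEntry L e dV hdV dW hdW) (-cmGramEntry L e dV hdV dW hdW) ((LocalSplitting.e₂ n).symm k)) (imagUnit L) σ) × PosIdx y) ≃
      NegIdx (signVec (cmPlaceOver L) (fun k => Sum.elim (cmGramEntry L e' dV hdV (tensorFrame L dW eW dV') (tensorFrame_real L dW hdW eW dV' hdV')) (-cmGramEntry L e' dV hdV (tensorFrame L dW eW dV') (tensorFrame_real L dW hdW eW dV' hdV')) ((LocalSplitting.e₂ n').symm k)) (imagUnit L) σ))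
    (hE : ∀ i, (dpEquiv _ _ _ _).symm ((eP₀.sumCongr eQ₀).symm i) =
      (signSplit (signVec (cmPlaceOver L) (fun k => Sum.elim (cmGramEntry L e dV hdV dW hdW) (-cmGramEntry L e dV hdV dW hdW) ((LocalSplitting.e₂ n).symm k)) (imagUnit L) σ)
        ((epsD e eW e').symm ((signSplit (signVec (cmPlaceOver L) (fun k => Sum.elim (cmGramEntry L e' dV hdV (tensorFrame L dW eW dV') (tensorFrame_real L dW hdW eW dV' hdV')) (-cmGramEntry L e' dV hdV (tensorFrame L dW eW dV') (tensorFrame_real L dW hdW eW dV' hdV')) ((LocalSplitting.e₂ n').symm k)) (imagUnit L) σ)).symm i)).1,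
       signSplit y ((epsD e eW e').symm ((signSplit (signVec (cmPlaceOver L) (fun k => Sum.elim (cmGramEntry L e' dV hdV (tensorFrame L dW eW dV') (tensorFrame_real L dW hdW eW dV' hdV')) (-cmGramEntry L e' dV hdV (tensorFrame L dW eW dV') (tensorFrame_real L dW hdW eW dV' hdV')) ((LocalSplitting.e₂ n').symm k)) (imagUnit L) σ)).symm i)).2))
    (eSp : P ≃ PosIdx (signVec (cmPlaceOver L) (fun k => Sum.elim (cmGramEntry L e dV hdV dW hdW) (-cmGramEntry L e dV hdV dW hdW) ((LocalSplitting.e₂ n).symm k)) (imagUnit L) σ))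
    (eSq : Q ≃ NegIdx (signVec (cmPlaceOver L) (fun k => Sum.elim (cmGramEntry L e dV hdV dW hdW) (-cmGramEntry L e dV hdV dW hdW) ((LocalSplitting.e₂ n).symm k)) (imagUnit L) σ))
    (f : FinSB (Fp L) (Fin (n' + n'))) (h : HA L e dV hdV dW hdW)
    (k : Matrix.unitaryGroup (PosIdx y) ℂ × Matrix.unitaryGroup (NegIdx y) ℂ) (Φ₁ : 𝓢((DPIdx P Q (PosIdx y) (NegIdx y) → ℝ), ℂ))
    (Φ₂ : 𝓢(((Fin (n' + n') × {v : {v : InfinitePlace (Fp L) // v.IsReal} // v ≠ σ}) → ℝ), ℂ))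
    (a a' : 𝓢((Fin (n' + n') → mixedSpace (Fp L)), ℂ))
    (ha : ((((schwartzTransport
                  (scaledFrame (Fp L) (Fin (n' + n'))
                    (placeScale (n' + n') fun v => sqrtAbs (signVec (cmPlaceOver L)
                      (fun k => Sum.elim (cmGramEntry L e' dV hdV (tensorFrame L dW eW dV') (tensorFrame_real L dW hdW eW dV' hdV')) (-cmGramEntry L e' dV hdV (tensorFrame L dW eW dV') (tensorFrame_real L dW hdW eW dV' hdV')) ((LocalSplitting.e₂ n').symm k))
                      (imagUnit L) v))
                    (placeScale_ne_zero (n' + n') (sqrtAbs_signVec_ne_zero (IsCMField.complexConj_ne_one L) (cmPlaceOver_smul L)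
                      (complexConj_imagUnit L) (imagUnit_ne_zero L) (gramD_gram_realDiagonal_entry_ne_zero L e' dV hdV (tensorFrame L dW eW dV') (tensorFrame_real L dW hdW eW dV' hdV') hdV0 (tensorFrame_ne_zero L dW eW dV' hdW0 hdV'0)))))).trans
                (schwartzTransport (reindexCLE (placeSplitEquiv (signSplit (signVec (cmPlaceOver L)
                  (fun k => Sum.elim (cmGramEntry L e' dV hdV (tensorFrame L dW eW dV') (tensorFrame_real L dW hdW eW dV' hdV')) (-cmGramEntry L e' dV hdV (tensorFrame L dW eW dV') (tensorFrame_real L dW hdW eW dV' hdV')) ((LocalSplitting.e₂ n').symm k))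
                  (imagUnit L) σ)) σ)))).trans
                (schwartzTransport (reindexCLE (Equiv.sumCongr
                  (unitJunctionIdx
                    (PosIdx (signVec (cmPlaceOver L)
                      (fun k => Sum.elim (cmGramEntry L e' dV hdV (tensorFrame L dW eW dV') (tensorFrame_real L dW hdW eW dV' hdV')) (-cmGramEntry L e' dV hdV (tensorFrame L dW eW dV') (tensorFrame_real L dW hdW eW dV' hdV')) ((LocalSplitting.e₂ n').symm k))
                      (imagUnit L) σ))
                    (NegIdx (signVec (cmPlaceOver L)
                      (fun k => Sum.elim (cmGramEntry L e' dV hdV (tensorFrame L dW eW dV') (tensorFrame_real L dW hdW eW dV' hdV')) (-cmGramEntry L e' dV hdV (tensorFrame L dW eW dV') (tensorFrame_real L dW hdW eW dV' hdV')) ((LocalSplitting.e₂ n').symm k))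
                      (imagUnit L) σ))).symm
                  (Equiv.refl (Fin (n' + n') × {v : {v : InfinitePlace (Fp L) // v.IsReal} // v ≠ σ})))))).trans
                (schwartzTransport (reindexCLE (Equiv.sumCongr
                  (dpIdxCongr
                    (PosIdx (signVec (cmPlaceOver L)
                      (fun k => Sum.elim (cmGramEntry L e' dV hdV (tensorFrame L dW eW dV') (tensorFrame_real L dW hdW eW dV' hdV')) (-cmGramEntry L e' dV hdV (tensorFrame L dW eW dV') (tensorFrame_real L dW hdW eW dV' hdV')) ((LocalSplitting.e₂ n').symm k))
                      (imagUnit L) σ))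
                    (NegIdx (signVec (cmPlaceOver L)
                      (fun k => Sum.elim (cmGramEntry L e' dV hdV (tensorFrame L dW eW dV') (tensorFrame_real L dW hdW eW dV' hdV')) (-cmGramEntry L e' dV hdV (tensorFrame L dW eW dV') (tensorFrame_real L dW hdW eW dV' hdV')) ((LocalSplitting.e₂ n').symm k))
                      (imagUnit L) σ))
                    Unit Empty ((P × (PosIdx y)) ⊕ (Q × (NegIdx y))) ((P × (NegIdx y)) ⊕ (Q × (PosIdx y))) Unit Empty (eP₀.symm.trans (Equiv.sumCongr (eSp.symm.prodCongr (Equiv.refl (PosIdx y))) (eSq.symm.prodCongr (Equiv.refl (NegIdx y))))) (eQ₀.symm.trans (Equiv.sumCongr (eSp.symm.prodCongr (Equiv.refl (NegIdx y))) (eSq.symm.prodCongr (Equiv.refl (PosIdx y))))) (Equiv.refl Unit) (Equiv.refl Empty)).symm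
                  (Equiv.refl (Fin (n' + n') × {v : {v : InfinitePlace (Fp L) // v.IsReal} // v ≠ σ})))))) a = tensorPi ((schwartzTransport (reindexCLE (unitJunctionIdx ((P × (PosIdx y)) ⊕ (Q × (NegIdx y))) ((P × (NegIdx y)) ⊕ (Q × (PosIdx y)))).symm)) Φ₁) Φ₂)
    (ha' : ((((schwartzTransport
                  (scaledFrame (Fp L) (Fin (n' + n'))
                    (placeScale (n' + n') fun v => sqrtAbs (signVec (cmPlaceOver L)
                      (fun k => Sum.elim (cmGramEntry L e' dV hdV (tensorFrame L dW eW dV') (tensorFrame_real L dW hdW eW dV' hdV')) (-cmGramEntry L e' dV hdV (tensorFrame L dW eW dV') (tensorFrame_real L dW hdW eW dV' hdV')) ((LocalSplitting.e₂ n').symm k))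
                      (imagUnit L) v))
                    (placeScale_ne_zero (n' + n') (sqrtAbs_signVec_ne_zero (IsCMField.complexConj_ne_one L) (cmPlaceOver_smul L)
                      (complexConj_imagUnit L) (imagUnit_ne_zero L) (gramD_gram_realDiagonal_entry_ne_zero L e' dV hdV (tensorFrame L dW eW dV') (tensorFrame_real L dW hdW eW dV' hdV') hdV0 (tensorFrame_ne_zero L dW eW dV' hdW0 hdV'0)))))).trans
                (schwartzTransport (reindexCLE (placeSplitEquiv (signSplit (signVec (cmPlaceOver L)
                  (fun k => Sum.elim (cmGramEntry L e' dV hdV (tensorFrame L dW eW dV') (tensorFrame_real L dW hdW eW dV' hdV')) (-cmGramEntry L e' dV hdV (tensorFrame L dW eW dV') (tensorFrame_real L dW hdW eW dV' hdV')) ((LocalSplitting.e₂ n').symm k))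
                  (imagUnit L) σ)) σ)))).trans
                (schwartzTransport (reindexCLE (Equiv.sumCongr
                  (unitJunctionIdx
                    (PosIdx (signVec (cmPlaceOver L)
                      (fun k => Sum.elim (cmGramEntry L e' dV hdV (tensorFrame L dW eW dV') (tensorFrame_real L dW hdW eW dV' hdV')) (-cmGramEntry L e' dV hdV (tensorFrame L dW eW dV') (tensorFrame_real L dW hdW eW dV' hdV')) ((LocalSplitting.e₂ n').symm k))
                      (imagUnit L) σ))
                    (NegIdx (signVec (cmPlaceOver L)
                      (fun k => Sum.elim (cmGramEntry L e' dV hdV (tensorFrame L dW eW dV') (tensorFrame_real L dW hdW eW dV' hdV')) (-cmGramEntry L e' dV hdV (tensorFrame L dW eW dV') (tensorFrame_real L dW hdW eW dV' hdV')) ((LocalSplitting.e₂ n').symm k))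
                      (imagUnit L) σ))).symm
                  (Equiv.refl (Fin (n' + n') × {v : {v : InfinitePlace (Fp L) // v.IsReal} // v ≠ σ})))))).trans
                (schwartzTransport (reindexCLE (Equiv.sumCongr
                  (dpIdxCongr
                    (PosIdx (signVec (cmPlaceOver L)
                      (fun k => Sum.elim (cmGramEntry L e' dV hdV (tensorFrame L dW eW dV') (tensorFrame_real L dW hdW eW dV' hdV')) (-cmGramEntry L e' dV hdV (tensorFrame L dW eW dV') (tensorFrame_real L dW hdW eW dV' hdV')) ((LocalSplitting.e₂ n').symm k))
                      (imagUnit L) σ))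
                    (NegIdx (signVec (cmPlaceOver L)
                      (fun k => Sum.elim (cmGramEntry L e' dV hdV (tensorFrame L dW eW dV') (tensorFrame_real L dW hdW eW dV' hdV')) (-cmGramEntry L e' dV hdV (tensorFrame L dW eW dV') (tensorFrame_real L dW hdW eW dV' hdV')) ((LocalSplitting.e₂ n').symm k))
                      (imagUnit L) σ))
                    Unit Empty ((P × (PosIdx y)) ⊕ (Q × (NegIdx y))) ((P × (NegIdx y)) ⊕ (Q × (PosIdx y))) Unit Empty (eP₀.symm.trans (Equiv.sumCongr (eSp.symm.prodCongr (Equiv.refl (PosIdx y))) (eSq.symm.prodCongr (Equiv.refl (NegIdx y))))) (eQ₀.symm.trans (Equiv.sumCongr (eSp.symm.prodCongr (Equiv.refl (NegIdx y))) (eSq.symm.prodCongr (Equiv.refl (PosIdx y))))) (Equiv.refl Unit) (Equiv.refl Empty)).symm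
                  (Equiv.refl (Fin (n' + n') × {v : {v : InfinitePlace (Fp L) // v.IsReal} // v ≠ σ})))))) a' =
      tensorPi ((schwartzTransport (reindexCLE (unitJunctionIdx ((P × (PosIdx y)) ⊕ (Q × (NegIdx y))) ((P × (NegIdx y)) ⊕ (Q × (PosIdx y)))).symm))
        (κOp (PosIdx y) (NegIdx y) (⟨-(Fintype.card (NegIdx y) : ℤ), -(Fintype.card (PosIdx y) : ℤ), -(Fintype.card Q : ℤ), -(Fintype.card P : ℤ)⟩ : VacExponents)
                (((1 : Matrix.unitaryGroup P ℂ × Matrix.unitaryGroup Q ℂ), k) : DPK P Q (PosIdx y) (NegIdx y)) Φ₁)) Φ₂) :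
    swSection L e' dV hdV hdV0 (tensorFrame L dW eW dV') (tensorFrame_real L dW hdW eW dV' hdV') (tensorFrame_ne_zero L dW eW dV' hdW0 hdV'0) sB
            (piSchwartzBruhatEquiv (Fp L) (Fin (n' + n')) (a' ⊗ₜ f))
            (tensorEmb L e dV hdV dW hdW eW e' dV' hdV' h) =
      vacScalar (⟨-(Fintype.card (NegIdx y) : ℤ), -(Fintype.card (PosIdx y) : ℤ), -(Fintype.card Q : ℤ), -(Fintype.card P : ℤ)⟩ : VacExponents) (((1 : Matrix.unitaryGroup P ℂ × Matrix.unitaryGroup Q ℂ), k) : DPK P Q (PosIdx y) (NegIdx y)) *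
        swSection L e' dV hdV hdV0 (tensorFrame L dW eW dV') (tensorFrame_real L dW hdW eW dV' hdV') (tensorFrame_ne_zero L dW eW dV' hdW0 hdV'0) sB
            (piSchwartzBruhatEquiv (Fp L) (Fin (n' + n')) (a ⊗ₜ f))
            (tensorEmb L e dV hdV dW hdW eW e' dV' hdV' h) := by
  -- (R-det): the determinant letters of the `adelicSingle` partner datum in the `y`-frame (★ p863469)
  obtain ⟨xx, hdet, hxσ, hx⟩ := exists_det_letters_adelicSingle_kV L M₂ (Matrix.diagonal dV') σ (signSplit y) (fun j => sqrtAbs_ne_zero (hy j)) one_ne_zero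
    (formCongr_yFrame L dV' hdV' σ y hy hyσ)
  -- ★ p863344 at `kk := k̂ σ ∘ kV`, (R-grp) `hkk` := ★ p863593
  exact swSection_junctionSlot_κOp_eq_vacScalar_mul L e dV hdV hdV0 dW hdW hdW0 eW e' dV' hdV' hdV'0 σ
    (eP₀.symm.trans (Equiv.sumCongr (eSp.symm.prodCongr (Equiv.refl (PosIdx y))) (eSq.symm.prodCongr (Equiv.refl (NegIdx y)))))
    (eQ₀.symm.trans (Equiv.sumCongr (eSp.symm.prodCongr (Equiv.refl (NegIdx y))) (eSq.symm.prodCongr (Equiv.refl (PosIdx y)))))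
    hχu hχs hsB ht hodd hPn hQn
    (fun k => UnitaryGroup.adelicSingle (Fp L) L (IsCMField.complexConj L) M₂ (Matrix.diagonal dV') (IsCMField.complexConj_ne_one L)
      (complexConj_smul_infinitePlace L) (cmPlaceOver L σ)
      ((toUFormEquiv (signSplit y) (fun j => sqrtAbs_ne_zero (hy j)) one_ne_zero (formCongr_yFrame L dV' hdV' σ y hy hyσ)).symm (UForm.kV (PosIdx y) (NegIdx y) k)))
    (fun k => partnerEmb_kHat_eq_archEmb_placeSecJ_κ L e dV hdV dW hdW eW e' dV' hdV' hdV0 hdW0 hdV'0 σ y hy hyσ hz eP₀ eQ₀ hE eSp eSq k)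
    xx hdet hxσ hx f h k Φ₁ Φ₂ a a' ha ha'

end Summit.HodgeConjecture.HodgeConjecture.Cruxes.HLiu418.K2LiuArchSWPivotDischarge

end
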